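import Mathlib.Analysis.Complex.RemovableSingularity
import Mathlib.Analysis.Complex.CauchyIntegral
import Mathlib.Analysis.Complex.Convex
import Mathlib.Analysis.Analytic.Order
import Mathlib.Analysis.Convex.PathConnected
import Mathlib.Analysis.SpecialFunctions.Complex.LogDeriv
import Literature.Analysis.Complex.HolomorphicPrimitives
import Literature.Analysis.Complex.HarmonicRemovableSingularity
import HarnessLib

/-!
# Bôcher's theorem: positive harmonic functions at an isolated singularity (planar case)

**Theorem (Bôcher 1903; Axler–Bourdon–Ramey, *Harmonic Function Theory*, Thm. 3.9, case `n = 2`).**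
Let `u` be harmonic on a punctured disc `B(b,R) ∖ {b} ⊆ ℂ` and bounded below there. Then there are a
constant `c ≤ 0` and a function `v` harmonic on the whole disc `B(b,R)` with
`u(z) = c · log|z - b| + v(z)` for `0 < |z - b| < R`
(equivalently, `u(z) = β log(1/|z-b|) + v(z)` with `β ≥ 0`). [cite: AxlerBourdonRamey2001, Thm. 3.9 (Bôcher's theorem), planar case]

We prove it in the "holomorphic clothing" in which it is consumed by the identification step of
Chelkak–Hongler–Izyurov's convergence theorems (Ann. of Math. 181 (2015), Prop. 3.9 (3) and the proof
of Thm. 2.16: "`h̃` is bounded from below in the neighborhoods of `a_j` … `h(z) = -c_j log|z-a_j| + O(1)`"):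
the datum is a holomorphic `q` on the punctured disc together with a real function `h` with
`dh = Re(q dz)` (so `h = Re ∫ q` is harmonic and single-valued), bounded below; the conclusion is
that `q` has at most a simple pole at `b` with a real non-positive residue,
`q = c/(z-b) + g`, `g` holomorphic on `B(b,R)`, and `h = c log|z-b| + Re Γ` with `Γ' = g`
(`exists_simplePole_of_re_primitive_bddBelow`). The classical statement for harmonic functions
follows by taking `q = 2∂u` (`exists_log_add_harmonic_of_harmonic_bddBelow`).

Proof (complex-analytic; cf. the bounded case in `HarmonicRemovableSingularity.lean`). The period
`∮ q dz` over a circle is purely imaginary (its real part is `∮ dh = 0`), say `2πic`, `c ∈ ℝ`; then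
`q₁ = q - c/(z-b)` has zero period, hence a primitive `Q₁` on the punctured disc (primitives on the
two slit discs `B ∖ (b ∓ i[0,R))`, which are hole-free, glued along the two half-discs: the
difference of the two gluing constants is the period). Now `h = Re Q₁ + c log|z-b| + κ`, so
`F = e^{-Q₁}` is zero-free holomorphic with `|F| = e^{κ - h}|z-b|^{c} ≤ e^{κ-M}|z-b|^{c}`: for
`N ≥ -c`, `(z-b)^N F` is bounded, hence extends holomorphically (Riemann) as `(z-b)^m U`, `U(b) ≠ 0`.
Comparing logarithmic derivatives, `q₁ = (N-m)/(z-b) - U'/U` near `b`, and integrating over a small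
circle (`∮ q₁ = 0`, `∮ U'/U = 0`) gives `N = m`, so `q₁ = -U'/U` extends holomorphically across `b`.
Finally `h = c log|z-b| + O(1)` bounded below forces `c ≤ 0`.

* `slitDisc b R u = B(b,R) ∩ {(z-b)u ∈ ℂ ∖ (-∞,0]}` is open, star-shaped and hole-free, so
  holomorphic functions on it have primitives (`Complex.isExactOn_slitDisc`, from
  `Complex.isExactOn_of_compl`, Conway VIII.2.2);
* `Complex.isExactOn_ball_diff_singleton_of_circleIntegral_eq_zero` — a holomorphic function on a
  punctured disc with one vanishing circle period has a primitive there;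
* `re_circleIntegral_eq_zero_of_hasFDerivAt` — `Re ∮ q dz = 0` when `Re(q dz) = dh` is exact;
* `exists_simplePole_of_re_primitive_bddBelow` — **Bôcher's theorem, holomorphic form**;
* `exists_log_add_harmonic_of_harmonic_bddBelow` — **Bôcher's theorem** for harmonic functions.

## References

* M. Bôcher, *Singular points of functions which satisfy partial differential equations of the
  elliptic type*, Bull. Amer. Math. Soc. 9 (1903) 455–465.
* S. Axler, P. Bourdon, W. Ramey, *Harmonic Function Theory*, 2nd ed., GTM 137, Springer (2001),
  Thm. 3.9 and the remarks following it (the case `n = 2`). [AxlerBourdonRamey2001]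
* J. B. Conway, *Functions of One Complex Variable I*, 2nd ed. (1978), Thm. VIII.2.2. [Conway1978]
* D. Chelkak, C. Hongler, K. Izyurov, Ann. of Math. (2) 181 (2015) 1087–1138, Prop. 3.9 and §3.4
  (where the statement is used). [ChelkakHonglerIzyurovAnnals2015]
-/

noncomputable section

open Set Filter Metric Topology Bornology Complex MeasureTheory InnerProductSpace
open scoped Real ComplexConjugate

namespace Complex

/-! ### 1. Slit discs are hole-free: primitives -/

/-- The disc `B(b,R)` slit along the closed ray `{z : (z-b)u ∈ (-∞,0]}` from its centre (for `u ≠ 0`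
this is the ray `b - [0,∞)·ū`): `B(b,R) ∩ {z | (z-b)u ∈ Complex.slitPlane}`. [folklore] -/
def slitDisc (b : ℂ) (R : ℝ) (u : ℂ) : Set ℂ := ball b R ∩ {z | (z - b) * u ∈ slitPlane}

/-- A slit disc is open. [folklore] -/
theorem isOpen_slitDisc (b : ℂ) (R : ℝ) (u : ℂ) : IsOpen (slitDisc b R u) :=
  isOpen_ball.inter (isOpen_slitPlane.preimage ((continuous_id.sub continuous_const).mul continuous_const))

/-- A slit disc lies in the punctured disc. [folklore] -/
theorem slitDisc_subset (b : ℂ) (R : ℝ) (u : ℂ) : slitDisc b R u ⊆ ball b R \ {b} := by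
  rintro z ⟨hz, hz'⟩
  refine ⟨hz, fun h => ?_⟩
  rw [mem_singleton_iff] at h
  subst h
  exact slitPlane_ne_zero hz' (by ring)

/-- A slit disc is star-shaped with respect to the point `b + (R/(2|u|)) ū` of the opposite ray.
[folklore] -/
theorem starConvex_slitDisc (b : ℂ) {R : ℝ} (hR : 0 < R) {u : ℂ} (hu : u ≠ 0) :
    StarConvex ℝ (b + ((R / (2 * ‖u‖) : ℝ) : ℂ) * conj u) (slitDisc b R u) ∧
      b + ((R / (2 * ‖u‖) : ℝ) : ℂ) * conj u ∈ slitDisc b R u := by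
  have hu0 : 0 < ‖u‖ := norm_pos_iff.2 hu
  set s : ℝ := R / (2 * ‖u‖) with hs
  have hs0 : 0 < s := by positivity
  set p : ℂ := b + (s : ℂ) * conj u with hp
  have hpb : (p - b) * u = ((s * ‖u‖ ^ 2 : ℝ) : ℂ) := by
    rw [hp, add_sub_cancel_left, mul_assoc, ← Complex.normSq_eq_conj_mul_self, Complex.normSq_eq_norm_sq]
    push_cast
    ring
  have hsu : 0 < s * ‖u‖ ^ 2 := by positivity
  have hp_ball : p ∈ ball b R := by
    rw [mem_ball, dist_eq_norm, hp, add_sub_cancel_left, norm_mul, Complex.norm_real, Complex.norm_conj,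
      Real.norm_of_nonneg hs0.le, hs]
    have : R / (2 * ‖u‖) * ‖u‖ = R / 2 := by field_simp
    rw [this]
    linarith
  have hp_mem : p ∈ slitDisc b R u := ⟨hp_ball, by
    show (p - b) * u ∈ slitPlane
    rw [hpb]
    exact ofReal_mem_slitPlane.2 hsu⟩
  refine ⟨StarConvex.inter ((convex_ball b R).starConvex hp_ball) ?_, hp_mem⟩
  intro y hy a t ha ht hat
  show (a • p + t • y - b) * u ∈ slitPlane
  have hb' : (b : ℂ) = a • b + t • b := by rw [← add_smul, hat, one_smul]
  have key : (a • p + t • y - b) * u = a • (((s * ‖u‖ ^ 2 : ℝ)) : ℂ) + t • ((y - b) * u) := by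
    rw [← hpb]
    conv_lhs => rw [hb']
    simp only [Complex.real_smul]
    ring
  rw [key]
  exact starConvex_ofReal_slitPlane hsu hy ha ht hat

/-- A slit disc is preconnected. [folklore] -/
theorem isPreconnected_slitDisc (b : ℂ) {R : ℝ} (hR : 0 < R) {u : ℂ} (hu : u ≠ 0) :
    IsPreconnected (slitDisc b R u) := by
  obtain ⟨h1, h2⟩ := starConvex_slitDisc b hR hu
  exact (h1.isPathConnected h2).isConnected.isPreconnected

/-- A closed ray `p + [0,∞)·v`, `v ≠ 0`, is unbounded. [folklore] -/
theorem not_isBounded_ray (p : ℂ) {v : ℂ} (hv : v ≠ 0) :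
    ¬ IsBounded ((fun t : ℝ => p + (t : ℂ) * v) '' Ici 0) := by
  intro h
  obtain ⟨C, hC⟩ := h.exists_norm_le
  have hv0 : 0 < ‖v‖ := norm_pos_iff.2 hv
  have hC0 : 0 ≤ C := (norm_nonneg _).trans (hC p ⟨0, self_mem_Ici, by simp⟩)
  set t : ℝ := (C + ‖p‖ + 1) / ‖v‖ with ht
  have ht0 : 0 ≤ t := by positivity
  have h1 := hC _ ⟨t, ht0, rfl⟩
  have h2 : ‖(t : ℂ) * v‖ = C + ‖p‖ + 1 := by
    rw [norm_mul, Complex.norm_real, Real.norm_of_nonneg ht0, ht]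
    field_simp
  have h3 : ‖(t : ℂ) * v‖ ≤ ‖p + (t : ℂ) * v‖ + ‖p‖ := by
    calc ‖(t : ℂ) * v‖ = ‖(p + (t : ℂ) * v) - p‖ := by ring_nf
      _ ≤ ‖p + (t : ℂ) * v‖ + ‖p‖ := norm_sub_le _ _
  linarith

/-- A closed ray is preconnected. [folklore] -/
theorem isPreconnected_ray (p v : ℂ) : IsPreconnected ((fun t : ℝ => p + (t : ℂ) * v) '' Ici 0) :=
  isPreconnected_Ici.image _ (by fun_prop : Continuous fun t : ℝ => p + (t : ℂ) * v).continuousOn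

/-- **Slit discs are hole-free**: every point of the complement of `slitDisc b R u` lies on a closed
ray inside the complement, so no component of the complement is bounded. [folklore] -/
theorem slitDisc_holeFree (b : ℂ) {R : ℝ} (hR : 0 < R) {u : ℂ} (hu : u ≠ 0) :
    ∀ p ∈ (slitDisc b R u)ᶜ, ¬ IsBounded (connectedComponentIn (slitDisc b R u)ᶜ p) := by
  intro p hp hbd
  by_cases hpball : p ∈ ball b R
  · -- `p` lies on the slit: the ray `p - [0,∞) ū` stays on the slit
    have hT : (p - b) * u ∉ slitPlane := fun h => hp ⟨hpball, h⟩
    rw [mem_slitPlane_iff, not_or, not_lt, not_ne_iff] at hT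
    set ray : Set ℂ := (fun t : ℝ => p + (t : ℂ) * (-conj u)) '' Ici 0 with hray
    have hsub : ray ⊆ (slitDisc b R u)ᶜ := by
      rintro _ ⟨t, ht, rfl⟩ ⟨-, hmem⟩
      change (p + (t : ℂ) * -conj u - b) * u ∈ slitPlane at hmem
      have hnn : ((‖u‖ : ℂ)) ^ 2 = conj u * u := by
        rw [← Complex.normSq_eq_conj_mul_self, Complex.normSq_eq_norm_sq]
        norm_cast
      have hid : (p + (t : ℂ) * -conj u - b) * u = (p - b) * u - ((t * ‖u‖ ^ 2 : ℝ) : ℂ) := by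
        push_cast
        rw [hnn]
        ring
      rw [hid, mem_slitPlane_iff] at hmem
      have ht' : 0 ≤ t * ‖u‖ ^ 2 := mul_nonneg (mem_Ici.1 ht) (sq_nonneg _)
      rcases hmem with h | h
      · simp only [Complex.sub_re, Complex.ofReal_re] at h
        linarith [hT.1]
      · simp only [Complex.sub_im, Complex.ofReal_im, sub_zero] at h
        exact h hT.2
    have hpray : p ∈ ray := ⟨0, self_mem_Ici, by simp⟩
    exact not_isBounded_ray p (neg_ne_zero.2 ((map_ne_zero _).2 hu))
      (hbd.subset ((isPreconnected_ray p _).subset_connectedComponentIn hpray hsub))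
  · -- `p` is outside the disc: the radial ray `p + [0,∞)(p-b)` stays outside
    have hpR : R ≤ dist p b := le_of_not_gt fun h => hpball (mem_ball.2 h)
    have hpb : p - b ≠ 0 := by
      intro h
      rw [dist_eq_norm, h, norm_zero] at hpR
      linarith
    set ray : Set ℂ := (fun t : ℝ => p + (t : ℂ) * (p - b)) '' Ici 0 with hray
    have hsub : ray ⊆ (slitDisc b R u)ᶜ := by
      rintro _ ⟨t, ht, rfl⟩ ⟨hmem, -⟩
      rw [mem_ball, dist_eq_norm] at hmem
      have hid : p + (t : ℂ) * (p - b) - b = ((1 + t : ℝ) : ℂ) * (p - b) := by push_cast; ring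
      have ht0 : 0 ≤ t := mem_Ici.1 ht
      rw [hid, norm_mul, Complex.norm_real, Real.norm_of_nonneg (by linarith)] at hmem
      rw [dist_eq_norm] at hpR
      have : ‖p - b‖ ≤ (1 + t) * ‖p - b‖ := by
        have h0 : 0 ≤ ‖p - b‖ := norm_nonneg _
        nlinarith
      linarith
    have hpray : p ∈ ray := ⟨0, self_mem_Ici, by simp⟩
    exact not_isBounded_ray p hpb
      (hbd.subset ((isPreconnected_ray p _).subset_connectedComponentIn hpray hsub))

/-- **Holomorphic functions on a slit disc have primitives** (the slit disc is open, connected and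
hole-free: Conway VIII.2.2 (c) ⇒ (f), `Complex.isExactOn_of_compl`).
[cite: Conway1978, Ch. VIII Thm. 2.2 ((c)⇒(f))] -/
theorem isExactOn_slitDisc (b : ℂ) {R : ℝ} (hR : 0 < R) {u : ℂ} (hu : u ≠ 0) {f : ℂ → ℂ}
    (hf : DifferentiableOn ℂ f (slitDisc b R u)) : IsExactOn f (slitDisc b R u) :=
  isExactOn_of_compl (isOpen_slitDisc b R u) (isPreconnected_slitDisc b hR hu)
    (slitDisc_holeFree b hR hu) hf

/-! ### 2. Zero period on a punctured disc ⇒ primitive -/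

/-- Real and imaginary parts of `circleMap b ρ θ - b = ρ e^{iθ}`. [folklore] -/
theorem circleMap_sub_center_re_im (b : ℂ) (ρ θ : ℝ) :
    (circleMap b ρ θ - b).re = ρ * Real.cos θ ∧ (circleMap b ρ θ - b).im = ρ * Real.sin θ := by
  rw [circleMap_sub_center, circleMap_zero]
  simp [Complex.exp_ofReal_mul_I_re, Complex.exp_ofReal_mul_I_im]

/-- The closed upper semicircle lies in the disc slit downwards. [folklore] -/
theorem circleMap_mem_slitDisc_negI {b : ℂ} {R ρ θ : ℝ} (hρ : 0 < ρ) (hρR : ρ < R)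
    (hθ : θ ∈ Icc 0 π) : circleMap b ρ θ ∈ slitDisc b R (-I) := by
  refine ⟨?_, ?_⟩
  · have := circleMap_mem_sphere b hρ.le θ
    rw [mem_sphere] at this
    rw [mem_ball, this]
    exact hρR
  · show (circleMap b ρ θ - b) * (-I) ∈ slitPlane
    obtain ⟨hre, him⟩ := circleMap_sub_center_re_im b ρ θ
    have hre' : ((circleMap b ρ θ - b) * (-I)).re = ρ * Real.sin θ := by rw [Complex.mul_re, hre, him]; simp
    have him' : ((circleMap b ρ θ - b) * (-I)).im = -(ρ * Real.cos θ) := by rw [Complex.mul_im, hre, him]; simp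
    rw [mem_slitPlane_iff, hre', him']
    rcases eq_or_lt_of_le hθ.1 with h0 | h0
    · right
      rw [← h0, Real.cos_zero]
      simp [hρ.ne']
    rcases eq_or_lt_of_le hθ.2 with hπ | hπ
    · right
      rw [hπ, Real.cos_pi]
      simp [hρ.ne']
    · left
      exact mul_pos hρ (Real.sin_pos_of_pos_of_lt_pi h0 hπ)

/-- The closed lower semicircle lies in the disc slit upwards. [folklore] -/
theorem circleMap_mem_slitDisc_I {b : ℂ} {R ρ θ : ℝ} (hρ : 0 < ρ) (hρR : ρ < R)
    (hθ : θ ∈ Icc π (2 * π)) : circleMap b ρ θ ∈ slitDisc b R I := by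
  refine ⟨?_, ?_⟩
  · have := circleMap_mem_sphere b hρ.le θ
    rw [mem_sphere] at this
    rw [mem_ball, this]
    exact hρR
  · show (circleMap b ρ θ - b) * I ∈ slitPlane
    obtain ⟨hre, him⟩ := circleMap_sub_center_re_im b ρ θ
    have hre' : ((circleMap b ρ θ - b) * I).re = -(ρ * Real.sin θ) := by rw [Complex.mul_re, hre, him]; simp
    have him' : ((circleMap b ρ θ - b) * I).im = ρ * Real.cos θ := by rw [Complex.mul_im, hre, him]; simp
    rw [mem_slitPlane_iff, hre', him']
    rcases eq_or_lt_of_le hθ.1 with h0 | h0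
    · right
      rw [← h0, Real.cos_pi]
      simp [hρ.ne']
    rcases eq_or_lt_of_le hθ.2 with hπ | hπ
    · right
      rw [hπ, Real.cos_two_pi]
      simp [hρ.ne']
    · left
      have h1 : 0 < Real.sin (θ - π) := Real.sin_pos_of_pos_of_lt_pi (by linarith) (by linarith)
      rw [Real.sin_sub_pi] at h1
      nlinarith

/-- **A holomorphic function on a punctured disc whose integral over one circle about the puncture
vanishes has a primitive on the punctured disc** (primitives on the two slit discs
`B(b,R) ∖ (b ∓ i[0,R))` differ by constants on the right and left half-discs; the difference of
the two constants is the period). [folklore] -/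
theorem isExactOn_ball_diff_singleton_of_circleIntegral_eq_zero {f : ℂ → ℂ} {b : ℂ} {R ρ : ℝ}
    (hf : DifferentiableOn ℂ f (ball b R \ {b})) (hρ : 0 < ρ) (hρR : ρ < R)
    (h0 : (∮ z in C(b, ρ), f z) = 0) : IsExactOn f (ball b R \ {b}) := by
  have hR : 0 < R := hρ.trans hρR
  have hI : (I : ℂ) ≠ 0 := I_ne_zero
  have hnI : (-I : ℂ) ≠ 0 := neg_ne_zero.2 I_ne_zero
  obtain ⟨P₁, hP₁⟩ := isExactOn_slitDisc b hR hnI (hf.mono (slitDisc_subset b R (-I)))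
  obtain ⟨P₂, hP₂⟩ := isExactOn_slitDisc b hR hI (hf.mono (slitDisc_subset b R I))
  -- membership criteria
  have memS₁ : ∀ z ∈ ball b R, (0 < (z - b).im ∨ (z - b).re ≠ 0) → z ∈ slitDisc b R (-I) := by
    intro z hz h
    refine ⟨hz, ?_⟩
    show (z - b) * (-I) ∈ slitPlane
    have hre' : ((z - b) * (-I)).re = (z - b).im := by simp [Complex.mul_re]
    have him' : ((z - b) * (-I)).im = -(z - b).re := by simp [Complex.mul_im]
    rw [mem_slitPlane_iff, hre', him', neg_ne_zero]
    exact h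
  have memS₂ : ∀ z ∈ ball b R, ((z - b).im < 0 ∨ (z - b).re ≠ 0) → z ∈ slitDisc b R I := by
    intro z hz h
    refine ⟨hz, ?_⟩
    show (z - b) * I ∈ slitPlane
    have hre' : ((z - b) * I).re = -(z - b).im := by simp [Complex.mul_re]
    have him' : ((z - b) * I).im = (z - b).re := by simp [Complex.mul_im]
    rw [mem_slitPlane_iff, hre', him', Left.neg_pos_iff]
    exact h
  -- the difference `P₁ - P₂` is constant on each of the two half-discs `{±(z-b).re > 0}`
  have hconst : ∀ (s : ℝ), (s = 1 ∨ s = -1) →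
      ∀ z ∈ ball b R, 0 < s * (z - b).re → ∀ w ∈ ball b R, 0 < s * (w - b).re →
        P₁ z - P₂ z = P₁ w - P₂ w := by
    intro s hs
    set H : Set ℂ := ball b R ∩ {z | 0 < s * (z - b).re} with hH
    have hHo : IsOpen H :=
      isOpen_ball.inter (isOpen_lt continuous_const (continuous_const.mul (Complex.continuous_re.comp
        (continuous_id.sub continuous_const))))
    have hHc : IsPreconnected H := by
      refine (Convex.inter (convex_ball b R) ?_).isPreconnected
      intro x hx y hy a t ha ht hat
      simp only [mem_setOf_eq, Complex.sub_re, Complex.add_re, Complex.real_smul, Complex.mul_re,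
        Complex.ofReal_re, Complex.ofReal_im, zero_mul, sub_zero] at hx hy ⊢
      have hb' : b.re = a * b.re + t * b.re := by rw [← add_mul, hat, one_mul]
      rw [hb']
      have : s * (a * x.re + t * y.re - (a * b.re + t * b.re)) = a * (s * (x.re - b.re)) + t * (s * (y.re - b.re)) := by
        ring
      rw [this]
      rcases eq_or_lt_of_le ha with ha0 | ha0
      · rw [← ha0, zero_add] at hat
        rw [← ha0, hat]
        simpa using hy
      · have := mul_pos ha0 hx
        have := mul_nonneg ht hy.le
        linarith
    have hsre : ∀ z, 0 < s * (z - b).re → (z - b).re ≠ 0 := by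
      intro z hz h
      rw [h, mul_zero] at hz
      exact lt_irrefl _ hz
    have hHS₁ : H ⊆ slitDisc b R (-I) := fun z hz => memS₁ z hz.1 (Or.inr (hsre z hz.2))
    have hHS₂ : H ⊆ slitDisc b R I := fun z hz => memS₂ z hz.1 (Or.inr (hsre z hz.2))
    have hderiv : ∀ z ∈ H, HasDerivAt (fun w => P₁ w - P₂ w) 0 z := by
      intro z hz
      have := (hP₁ z (hHS₁ hz)).fun_sub (hP₂ z (hHS₂ hz))
      rwa [sub_self] at this
    have hd : DifferentiableOn ℂ (fun w => P₁ w - P₂ w) H := fun z hz =>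
      (hderiv z hz).differentiableAt.differentiableWithinAt
    have hd0 : EqOn (deriv fun w => P₁ w - P₂ w) 0 H := fun z hz => (hderiv z hz).deriv
    intro z hz hzs w hw hws
    exact hHo.is_const_of_deriv_eq_zero hHc hd hd0 ⟨hz, hzs⟩ ⟨hw, hws⟩
  -- the two base points `b ± ρ`
  have hρmem : ∀ t : ℝ, |t| = ρ → b + (t : ℂ) ∈ ball b R := by
    intro t ht
    rw [mem_ball, dist_eq_norm, add_sub_cancel_left, Complex.norm_real, Real.norm_eq_abs, ht]
    exact hρR
  have hplus : b + (ρ : ℂ) ∈ ball b R := hρmem ρ (abs_of_pos hρ)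
  have hminus : b + ((-ρ : ℝ) : ℂ) ∈ ball b R := hρmem (-ρ) (by rw [abs_neg, abs_of_pos hρ])
  set κ : ℂ := P₁ (b + ρ) - P₂ (b + ρ) with hκ
  set κ' : ℂ := P₁ (b + ((-ρ : ℝ) : ℂ)) - P₂ (b + ((-ρ : ℝ) : ℂ)) with hκ'
  -- the circle integral equals `κ' - κ`
  have hcm0 : circleMap b ρ 0 = b + ρ := by simp [circleMap]
  have hcmπ : circleMap b ρ π = b + ((-ρ : ℝ) : ℂ) := by
    simp [circleMap, Complex.exp_pi_mul_I]
  have hcm2π : circleMap b ρ (2 * π) = b + ρ := by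
    have := periodic_circleMap b ρ 0
    rw [zero_add] at this
    rw [this, hcm0]
  have hsphere : sphere b ρ ⊆ ball b R \ {b} := by
    intro z hz
    refine ⟨?_, ?_⟩
    · rw [mem_ball, mem_sphere.1 hz]; exact hρR
    · intro h
      rw [h, mem_sphere, dist_self] at hz
      exact hρ.ne' hz.symm
  have hcont : Continuous fun θ : ℝ => deriv (circleMap b ρ) θ • f (circleMap b ρ θ) := by
    simp_rw [deriv_circleMap]
    refine ((continuous_circleMap 0 ρ).mul continuous_const).smul ?_
    exact (hf.continuousOn.mono hsphere).comp_continuous (continuous_circleMap b ρ)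
      (fun θ => circleMap_mem_sphere b hρ.le θ)
  have hint : ∀ s t : ℝ, IntervalIntegrable (fun θ : ℝ => deriv (circleMap b ρ) θ • f (circleMap b ρ θ))
      volume s t := fun s t => hcont.intervalIntegrable _ _
  have hFTC : ∀ (P : ℂ → ℂ) (s t : ℝ), s ≤ t →
      (∀ θ ∈ Icc s t, HasDerivAt P (f (circleMap b ρ θ)) (circleMap b ρ θ)) →
      ∫ θ in s..t, deriv (circleMap b ρ) θ • f (circleMap b ρ θ) = P (circleMap b ρ t) - P (circleMap b ρ s) := by
    intro P s t hst hP
    apply intervalIntegral.integral_eq_sub_of_hasDerivAt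
    · intro θ hθ
      rw [uIcc_of_le hst] at hθ
      have h := (hP θ hθ).comp θ (hasDerivAt_circleMap b ρ θ)
      refine h.congr_deriv ?_
      rw [deriv_circleMap, smul_eq_mul, mul_comm]
    · exact hint s t
  have h1 : ∫ θ in (0 : ℝ)..π, deriv (circleMap b ρ) θ • f (circleMap b ρ θ) =
      P₁ (b + ((-ρ : ℝ) : ℂ)) - P₁ (b + ρ) := by
    rw [hFTC P₁ 0 π Real.pi_pos.le (fun θ hθ => hP₁ _ (circleMap_mem_slitDisc_negI hρ hρR hθ)), hcmπ, hcm0]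
  have h2 : ∫ θ in π..(2 * π), deriv (circleMap b ρ) θ • f (circleMap b ρ θ) =
      P₂ (b + ρ) - P₂ (b + ((-ρ : ℝ) : ℂ)) := by
    rw [hFTC P₂ π (2 * π) (by linarith [Real.pi_pos])
      (fun θ hθ => hP₂ _ (circleMap_mem_slitDisc_I hρ hρR hθ)), hcm2π, hcmπ]
  have hκκ' : κ = κ' := by
    have hsplit := intervalIntegral.integral_add_adjacent_intervals (hint 0 π) (hint π (2 * π))
    rw [h1, h2] at hsplit
    change _ = circleIntegral f b ρ at hsplit
    rw [h0] at hsplit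
    rw [hκ, hκ']
    linear_combination -hsplit
  -- the glued primitive
  refine ⟨fun z => if 0 < (z - b).im then P₁ z else P₂ z + κ, fun z hz => ?_⟩
  have hzball : z ∈ ball b R := hz.1
  have hzb : z ≠ b := fun h => hz.2 h
  rcases lt_trichotomy 0 (z - b).im with him | him | him
  · -- upper half: locally `P₁`
    have hev : (fun w => if 0 < (w - b).im then P₁ w else P₂ w + κ) =ᶠ[𝓝 z] P₁ := by
      have hc : Continuous fun w : ℂ => (w - b).im := by fun_prop
      have : ∀ᶠ w in 𝓝 z, 0 < (w - b).im := hc.continuousAt.tendsto.eventually (Ioi_mem_nhds him)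
      filter_upwards [this] with w hw
      rw [if_pos hw]
    exact (hP₁ z (memS₁ z hzball (Or.inl him))).congr_of_eventuallyEq hev
  · -- on the horizontal diameter (minus the centre): locally `P₂ + κ`
    have hre : (z - b).re ≠ 0 := by
      intro h
      apply hzb
      have : z - b = 0 := Complex.ext (by simpa using h) (by simpa using him.symm)
      exact sub_eq_zero.1 this
    -- the sign of the real part
    obtain ⟨s, hs, hsz⟩ : ∃ s : ℝ, (s = 1 ∨ s = -1) ∧ 0 < s * (z - b).re := by
      rcases lt_or_gt_of_ne hre with h | h
      · exact ⟨-1, Or.inr rfl, by linarith⟩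
      · exact ⟨1, Or.inl rfl, by linarith⟩
    -- `P₁ - P₂ = κ` on the half-disc of `z`
    have hκz : ∀ w ∈ ball b R, 0 < s * (w - b).re → P₁ w - P₂ w = κ := by
      intro w hw hws
      rcases hs with hs1 | hs1
      · rw [hκ]
        refine hconst s (Or.inl hs1) w hw hws (b + ρ) hplus ?_
        rw [hs1, add_sub_cancel_left, Complex.ofReal_re, one_mul]
        exact hρ
      · rw [hκκ', hκ']
        refine hconst s (Or.inr hs1) w hw hws (b + ((-ρ : ℝ) : ℂ)) hminus ?_
        rw [hs1, add_sub_cancel_left, Complex.ofReal_re]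
        linarith
    have hev : (fun w => if 0 < (w - b).im then P₁ w else P₂ w + κ) =ᶠ[𝓝 z] fun w => P₂ w + κ := by
      have hc : Continuous fun w : ℂ => s * (w - b).re := by fun_prop
      have h1 : ∀ᶠ w in 𝓝 z, 0 < s * (w - b).re := hc.continuousAt.tendsto.eventually (Ioi_mem_nhds hsz)
      have h2 : ∀ᶠ w in 𝓝 z, w ∈ ball b R := isOpen_ball.mem_nhds hzball
      filter_upwards [h1, h2] with w hw1 hw2
      by_cases hwi : 0 < (w - b).im
      · rw [if_pos hwi, ← hκz w hw2 hw1]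
        ring
      · rw [if_neg hwi]
    exact ((hP₂ z (memS₂ z hzball (Or.inr hre))).add_const κ).congr_of_eventuallyEq hev
  · -- lower half: locally `P₂ + κ`
    have hev : (fun w => if 0 < (w - b).im then P₁ w else P₂ w + κ) =ᶠ[𝓝 z] fun w => P₂ w + κ := by
      have hc : Continuous fun w : ℂ => (w - b).im := by fun_prop
      have : ∀ᶠ w in 𝓝 z, (w - b).im < 0 := hc.continuousAt.tendsto.eventually (Iio_mem_nhds him)
      filter_upwards [this] with w hw
      rw [if_neg (not_lt.2 hw.le)]
    exact ((hP₂ z (memS₂ z hzball (Or.inl him))).add_const κ).congr_of_eventuallyEq hev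

end Complex

namespace Literature.Analysis.Complex

/-! ### 3. The period of `q` is imaginary when `Re(q dz)` is exact -/

/-- **`Re ∮ q dz = ∮ dh = 0`**: if the real function `h` has differential `v ↦ Re(q(z) v)` along a
circle on which `q` is continuous, the circle integral of `q` is purely imaginary. [folklore] -/
theorem re_circleIntegral_eq_zero_of_hasFDerivAt {q : ℂ → ℂ} {h : ℂ → ℝ} {ℓ : ℂ → (ℂ →L[ℝ] ℝ)}
    {b : ℂ} {ρ : ℝ} (hρ : 0 ≤ ρ) (hq : ContinuousOn q (sphere b ρ))
    (hh : ∀ z ∈ sphere b ρ, HasFDerivAt h (ℓ z) z) (hℓ : ∀ z ∈ sphere b ρ, ∀ v, ℓ z v = (q z * v).re) :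
    (∮ z in C(b, ρ), q z).re = 0 := by
  have hcont : Continuous fun θ : ℝ => deriv (circleMap b ρ) θ • q (circleMap b ρ θ) := by
    simp_rw [deriv_circleMap]
    exact ((continuous_circleMap 0 ρ).mul continuous_const).smul
      (hq.comp_continuous (continuous_circleMap b ρ) (fun θ => circleMap_mem_sphere b hρ θ))
  rw [circleIntegral, ← reCLM_apply, ← ContinuousLinearMap.intervalIntegral_comp_comm _ (hcont.intervalIntegrable _ _)]
  have hderiv : ∀ θ : ℝ, HasDerivAt (fun θ => h (circleMap b ρ θ))
      (reCLM (deriv (circleMap b ρ) θ • q (circleMap b ρ θ))) θ := by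
    intro θ
    have hmem := circleMap_mem_sphere b hρ θ
    have h1 := (hh _ hmem).comp_hasDerivAt θ (hasDerivAt_circleMap b ρ θ)
    refine h1.congr_deriv ?_
    rw [hℓ _ hmem, reCLM_apply, deriv_circleMap, smul_eq_mul]
    congr 1
    ring
  rw [intervalIntegral.integral_eq_sub_of_hasDerivAt (fun θ _ => hderiv θ)
    ((reCLM.continuous.comp hcont).intervalIntegrable _ _)]
  have := periodic_circleMap b ρ 0
  rw [zero_add] at this
  rw [this, sub_self]

/-! ### 4. Bôcher's theorem -/

/-- Power bookkeeping: `(z-b) · (N (z-b)^{N-1}) = N (z-b)^N` for every natural `N` (both sides vanish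
for `N = 0`). [folklore] -/
theorem sub_mul_natDeriv_pow (z b : ℂ) (N : ℕ) :
    (z - b) * ((N : ℂ) * (z - b) ^ (N - 1)) = (N : ℂ) * (z - b) ^ N := by
  cases N with
  | zero => simp
  | succ k =>
    rw [Nat.add_sub_cancel, pow_succ]
    ring

/-- **Bôcher's theorem, holomorphic form.** Let `q` be holomorphic on the punctured disc
`B(b,R) ∖ {b}` and let `h` be a real function there with `dh = Re(q dz)` (i.e. with Fréchet
derivative `v ↦ Re(q(z)v)`; so `h` is a single-valued branch of `Re ∫ q`), bounded below. Then there
is a real constant `c ≤ 0`, a function `g` holomorphic on the whole disc and a primitive `Γ` of `g`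
there such that `q = c/(z-b) + g` and `h = c log|z-b| + Re Γ` on the punctured disc: `q` has at most
a simple pole, with real non-positive residue, and `h = c log|z-b| +` (harmonic).
[cite: AxlerBourdonRamey2001, Thm. 3.9 (Bôcher's theorem), planar case] -/
theorem exists_simplePole_of_re_primitive_bddBelow {q : ℂ → ℂ} {h : ℂ → ℝ} {ℓ : ℂ → (ℂ →L[ℝ] ℝ)}
    {b : ℂ} {R M : ℝ} (hR : 0 < R) (hq : DifferentiableOn ℂ q (ball b R \ {b}))
    (hh : ∀ z ∈ ball b R \ {b}, HasFDerivAt h (ℓ z) z)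
    (hℓ : ∀ z ∈ ball b R \ {b}, ∀ v, ℓ z v = (q z * v).re)
    (hM : ∀ z ∈ ball b R \ {b}, M ≤ h z) :
    ∃ c : ℝ, c ≤ 0 ∧ ∃ g Γ : ℂ → ℂ, DifferentiableOn ℂ g (ball b R) ∧
      (∀ z ∈ ball b R, HasDerivAt Γ (g z) z) ∧
      (∀ z ∈ ball b R \ {b}, q z = c / (z - b) + g z) ∧
      ∀ z ∈ ball b R \ {b}, h z = c * Real.log ‖z - b‖ + (Γ z).re := by
  set D : Set ℂ := ball b R \ {b} with hD
  have hDo : IsOpen D := isOpen_ball.sdiff isClosed_singleton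
  have hDc : IsPreconnected D := Literature.Topology.Euclidean.isPreconnected_ball_diff_singleton b R
  have hmemD : ∀ {z : ℂ}, z ∈ D ↔ dist z b < R ∧ z ≠ b := fun {z} => by simp [hD, mem_ball]
  have hsphere : ∀ {ρ : ℝ}, 0 < ρ → ρ < R → sphere b ρ ⊆ D := by
    intro ρ hρ hρR z hz
    refine hmemD.2 ⟨by rw [mem_sphere.1 hz]; exact hρR, fun h => ?_⟩
    rw [h, mem_sphere, dist_self] at hz
    exact hρ.ne' hz.symm
  /- Step 1: the period is `2πic`, `c` real -/
  set ρ₀ : ℝ := R / 2 with hρ₀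
  have hρ₀0 : 0 < ρ₀ := by positivity
  have hρ₀R : ρ₀ < R := by rw [hρ₀]; linarith
  set c : ℝ := (∮ z in C(b, ρ₀), q z).im / (2 * π) with hc
  have hperiod : (∮ z in C(b, ρ₀), q z) = ((2 * π * c : ℝ) : ℂ) * I := by
    have hre := re_circleIntegral_eq_zero_of_hasFDerivAt hρ₀0.le (hq.continuousOn.mono (hsphere hρ₀0 hρ₀R))
      (fun z hz => hh z (hsphere hρ₀0 hρ₀R hz)) (fun z hz => hℓ z (hsphere hρ₀0 hρ₀R hz))
    apply Complex.ext
    · simp [hre]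
    · simp only [Complex.mul_im, Complex.ofReal_re, Complex.I_im, mul_one, Complex.ofReal_im, Complex.I_re,
        mul_zero, add_zero, hc]
      field_simp
  /- Step 2: `q₁ = q - c/(z-b)` has zero period -/
  set q₁ : ℂ → ℂ := fun z => q z - c / (z - b) with hq₁
  have hq₁d : DifferentiableOn ℂ q₁ D := by
    refine hq.sub (DifferentiableOn.div (differentiableOn_const _) (by fun_prop) fun z hz => ?_)
    exact sub_ne_zero.2 (hmemD.1 hz).2
  have hq₁0 : (∮ z in C(b, ρ₀), q₁ z) = 0 := by
    have hci : CircleIntegrable q b ρ₀ := (hq.continuousOn.mono (hsphere hρ₀0 hρ₀R)).circleIntegrable hρ₀0.le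
    have hci' : CircleIntegrable (fun z => c / (z - b)) b ρ₀ := by
      refine ContinuousOn.circleIntegrable hρ₀0.le (ContinuousOn.div continuousOn_const (by fun_prop) ?_)
      exact fun z hz => sub_ne_zero.2 (hmemD.1 (hsphere hρ₀0 hρ₀R hz)).2
    change (∮ z in C(b, ρ₀), (q z - c / (z - b))) = 0
    rw [circleIntegral.integral_sub hci hci', hperiod]
    have : (∮ z in C(b, ρ₀), (c : ℂ) / (z - b)) = c * (2 * π * I) := by
      simp_rw [div_eq_mul_inv]
      rw [circleIntegral.integral_const_mul, circleIntegral.integral_sub_center_inv b hρ₀0.ne']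
    rw [this]
    push_cast
    ring
  /- Step 3: a primitive `Q₁` of `q₁` on the punctured disc -/
  obtain ⟨Q₁, hQ₁⟩ := Complex.isExactOn_ball_diff_singleton_of_circleIntegral_eq_zero hq₁d hρ₀0 hρ₀R hq₁0
  /- Step 4: `h = Re Q₁ + c log|z-b| + κ` on `D` -/
  set w : ℂ → ℝ := fun z => h z - c / 2 * Real.log (‖z - b‖ ^ 2) - (Q₁ z).re with hw
  have hwderiv : ∀ z ∈ D, HasFDerivAt w (0 : ℂ →L[ℝ] ℝ) z := by
    intro z hz
    have hzb : z ≠ b := (hmemD.1 hz).2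
    have hzb' : z - b ≠ 0 := sub_ne_zero.2 hzb
    have hnorm : ‖z - b‖ ^ 2 ≠ 0 := pow_ne_zero _ (norm_ne_zero_iff.2 hzb')
    have h1 : HasFDerivAt h (ℓ z) z := hh z hz
    have h2 : HasFDerivAt (fun z : ℂ => c / 2 * Real.log (‖z - b‖ ^ 2))
        ((c / 2) • ((‖z - b‖ ^ 2)⁻¹ • ((2 : ℕ) • (innerSL ℝ (z - b)).comp (ContinuousLinearMap.id ℝ ℂ)))) z :=
      (((hasFDerivAt_id z).sub_const b).norm_sq.log hnorm).const_mul _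
    have h3 : HasFDerivAt (fun z => (Q₁ z).re)
        (reCLM.comp ((ContinuousLinearMap.smulRight (1 : ℂ →L[ℂ] ℂ) (q₁ z)).restrictScalars ℝ)) z :=
      reCLM.hasFDerivAt.comp z ((hQ₁ z hz).hasFDerivAt.restrictScalars ℝ)
    have hsum := (h1.sub h2).sub h3
    refine hsum.congr_fderiv (ContinuousLinearMap.ext fun v => ?_)
    simp only [_root_.sub_apply, _root_.smul_apply, ContinuousLinearMap.comp_apply,
      ContinuousLinearMap.id_apply, innerSL_apply_apply, Complex.inner, ContinuousLinearMap.coe_restrictScalars',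
      ContinuousLinearMap.smulRight_apply, one_apply_eq_self, reCLM_apply,
      _root_.zero_apply, smul_eq_mul, hℓ z hz v, hq₁]
    set d : ℂ := z - b with hd
    have hd2 : ‖d‖ ^ 2 = d.re ^ 2 + d.im ^ 2 := by rw [Complex.sq_norm, Complex.normSq_apply]; ring
    have hdnz : d.re ^ 2 + d.im ^ 2 ≠ 0 := by rw [← hd2]; exact hnorm
    rw [hd2]
    simp only [Complex.sub_re, Complex.mul_re, Complex.sub_im, Complex.div_re, Complex.div_im,
      Complex.ofReal_re, Complex.ofReal_im, Complex.normSq_apply, Complex.conj_re, Complex.conj_im, nsmul_eq_mul,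
      Nat.cast_ofNat]
    field_simp
    ring
  have hwd : DifferentiableOn ℝ w D := fun z hz => (hwderiv z hz).differentiableAt.differentiableWithinAt
  have hw0 : EqOn (fderiv ℝ w) 0 D := fun z hz => (hwderiv z hz).fderiv
  obtain ⟨κ, hκ⟩ := hDo.exists_is_const_of_fderiv_eq_zero hDc hwd hw0
  have hlog2 : ∀ z : ℂ, c / 2 * Real.log (‖z - b‖ ^ 2) = c * Real.log ‖z - b‖ := by
    intro z
    rw [Real.log_pow, Nat.cast_ofNat]
    ring
  have hhQ : ∀ z ∈ D, h z = (Q₁ z).re + c * Real.log ‖z - b‖ + κ := by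
    intro z hz
    have := hκ z hz
    simp only [hw] at this
    rw [hlog2 z] at this
    linarith
  /- Step 5: `F = e^{-Q₁}`; `(z-b)^N F` is bounded near `b` for `N ≥ -c` -/
  set N : ℕ := ⌈-c⌉₊ with hN
  have hNc : 0 ≤ (N : ℝ) + c := by
    have := Nat.le_ceil (-c)
    rw [← hN] at this
    linarith
  set r₁ : ℝ := min ρ₀ 1 with hr₁
  have hr₁0 : 0 < r₁ := lt_min hρ₀0 one_pos
  have hr₁R : r₁ < R := (min_le_left _ _).trans_lt hρ₀R
  have hr₁1 : r₁ ≤ 1 := min_le_right _ _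
  have hD₁D : ball b r₁ \ {b} ⊆ D := fun z hz => hmemD.2 ⟨(mem_ball.1 hz.1).trans hr₁R, hz.2⟩
  set F : ℂ → ℂ := fun z => exp (-(Q₁ z)) with hF
  have hFderiv : ∀ z ∈ D, HasDerivAt F (F z * -(q₁ z)) z := fun z hz => by
    simpa [hF] using (hQ₁ z hz).neg.cexp
  have hFd : DifferentiableOn ℂ F D := fun z hz => (hFderiv z hz).differentiableAt.differentiableWithinAt
  have hF0 : ∀ z, F z ≠ 0 := fun z => exp_ne_zero _
  have hnormF : ∀ z ∈ D, ‖F z‖ = Real.exp (κ - h z + c * Real.log ‖z - b‖) := by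
    intro z hz
    rw [hF]
    simp only [Complex.norm_exp, Complex.neg_re]
    congr 1
    have := hhQ z hz
    linarith
  set V : ℂ → ℂ := fun z => (z - b) ^ N * F z with hV
  have hVd : DifferentiableOn ℂ V (ball b r₁ \ {b}) :=
    DifferentiableOn.mul (by fun_prop) (hFd.mono hD₁D)
  have hVbound : ∀ z ∈ ball b r₁ \ {b}, ‖V z‖ ≤ Real.exp (κ - M) := by
    intro z hz
    have hzD := hD₁D hz
    have ht0 : 0 < ‖z - b‖ := norm_pos_iff.2 (sub_ne_zero.2 hz.2)
    have ht1 : ‖z - b‖ ≤ 1 := by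
      have := mem_ball.1 hz.1
      rw [dist_eq_norm] at this
      linarith
    have hlog : Real.log ‖z - b‖ ≤ 0 := Real.log_nonpos ht0.le ht1
    rw [hV]
    simp only [norm_mul, norm_pow]
    rw [hnormF z hzD, ← Real.exp_log (pow_pos ht0 N), ← Real.exp_add, Real.log_pow]
    apply Real.exp_le_exp.2
    have h1 : M ≤ h z := hM z hzD
    have h2 : ((N : ℝ) + c) * Real.log ‖z - b‖ ≤ 0 := mul_nonpos_of_nonneg_of_nonpos hNc hlog
    nlinarith
  have hVbdd : BddAbove (norm ∘ V '' (ball b r₁ \ {b})) := by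
    refine ⟨Real.exp (κ - M), ?_⟩
    rintro _ ⟨z, hz, rfl⟩
    exact hVbound z hz
  set W : ℂ → ℂ := Function.update V b (limUnder (𝓝[≠] b) V) with hW
  have hWd : DifferentiableOn ℂ W (ball b r₁) :=
    Complex.differentiableOn_update_limUnder_of_bddAbove (ball_mem_nhds b hr₁0) hVd hVbdd
  have hWz : ∀ z, z ≠ b → W z = V z := fun z hz => by simp only [hW, Function.update_of_ne hz]
  /- Step 6: `W = (z-b)^m U` with `U(b) ≠ 0` -/
  have hWan : AnalyticAt ℂ W b := hWd.analyticAt (ball_mem_nhds b hr₁0)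
  have hWtop : analyticOrderAt W b ≠ ⊤ := by
    intro htop
    rw [analyticOrderAt_eq_top] at htop
    have h1 : ∀ᶠ z in 𝓝[≠] b, W z = 0 := htop.filter_mono nhdsWithin_le_nhds
    have h2 : ∀ᶠ z in 𝓝[≠] b, z ≠ b := eventually_nhdsWithin_of_forall fun z hz => hz
    obtain ⟨z, hz1, hz2⟩ := (h1.and h2).exists
    rw [hWz z hz2, hV] at hz1
    simp only [mul_eq_zero, pow_eq_zero_iff', sub_eq_zero, ne_eq] at hz1
    rcases hz1 with ⟨h, -⟩ | h
    · exact hz2 h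
    · exact hF0 z h
  obtain ⟨U, hUan, hUb, hWU⟩ := hWan.analyticOrderAt_ne_top.1 hWtop
  set m : ℕ := analyticOrderNatAt W b with hm
  -- a small disc on which everything is explicit
  obtain ⟨r₂, hr₂0, hr₂⟩ : ∃ r₂ > 0, r₂ ≤ r₁ ∧ ∀ z ∈ ball b r₂,
      W z = (z - b) ^ m * U z ∧ AnalyticAt ℂ U z ∧ U z ≠ 0 := by
    have e1 : ∀ᶠ z in 𝓝 b, W z = (z - b) ^ m * U z := by
      filter_upwards [hWU] with z hz
      rw [hz, smul_eq_mul]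
    have e2 : ∀ᶠ z in 𝓝 b, AnalyticAt ℂ U z := hUan.eventually_analyticAt
    have e3 : ∀ᶠ z in 𝓝 b, U z ≠ 0 := hUan.continuousAt.eventually_ne hUb
    have e4 : ∀ᶠ z in 𝓝 b, z ∈ ball b r₁ := ball_mem_nhds b hr₁0
    obtain ⟨r, hr0, hr⟩ := Metric.eventually_nhds_iff_ball.1 (e1.and (e2.and (e3.and e4)))
    refine ⟨min r r₁, lt_min hr0 hr₁0, min_le_right _ _, fun z hz => ?_⟩
    have hz' : z ∈ ball b r := ball_subset_ball (min_le_left _ _) hz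
    exact ⟨(hr z hz').1, (hr z hz').2.1, (hr z hz').2.2.1⟩
  have hr₂R : r₂ < R := (hr₂.1.trans_lt hr₁R)
  have hD₂D : ball b r₂ \ {b} ⊆ D := fun z hz => hmemD.2 ⟨(mem_ball.1 hz.1).trans hr₂R, hz.2⟩
  have hUd : DifferentiableOn ℂ U (ball b r₂) := fun z hz => (hr₂.2 z hz).2.1.differentiableAt.differentiableWithinAt
  have hUan' : AnalyticOnNhd ℂ U (ball b r₂) := fun z hz => (hr₂.2 z hz).2.1
  have hU0 : ∀ z ∈ ball b r₂, U z ≠ 0 := fun z hz => (hr₂.2 z hz).2.2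
  set L : ℂ → ℂ := fun z => deriv U z / U z with hL
  have hLd : DifferentiableOn ℂ L (ball b r₂) := (hUan'.deriv.differentiableOn).div hUd hU0
  /- Step 7: logarithmic derivatives: `q₁ = (N - m)/(z-b) - U'/U` on the small punctured disc -/
  have hlogder : ∀ z ∈ ball b r₂ \ {b}, q₁ z = ((N : ℂ) - m) / (z - b) - L z := by
    intro z hz
    have hzD := hD₂D hz
    have hzb : z - b ≠ 0 := sub_ne_zero.2 hz.2
    have hzball : z ∈ ball b r₂ := hz.1
    -- the two sides agree near `z`
    have hev : V =ᶠ[𝓝 z] fun w => (w - b) ^ m * U w := by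
      have e1 : ∀ᶠ w in 𝓝 z, w ≠ b := eventually_ne_nhds hz.2
      have e2 : ∀ᶠ w in 𝓝 z, w ∈ ball b r₂ := isOpen_ball.mem_nhds hzball
      filter_upwards [e1, e2] with w hw1 hw2
      rw [← hWz w hw1, (hr₂.2 w hw2).1]
    -- derivatives of both sides
    have hdV : HasDerivAt V ((N : ℂ) * (z - b) ^ (N - 1) * F z + (z - b) ^ N * (F z * -(q₁ z))) z := by
      have hp : HasDerivAt (fun w => (w - b) ^ N) ((N : ℂ) * (z - b) ^ (N - 1)) z :=
        (((hasDerivAt_id' z).sub_const b).fun_pow N).congr_deriv (mul_one _)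
      exact hp.mul (hFderiv z hzD)
    have hdU : HasDerivAt (fun w => (w - b) ^ m * U w) ((m : ℂ) * (z - b) ^ (m - 1) * U z + (z - b) ^ m * deriv U z) z := by
      have hp : HasDerivAt (fun w => (w - b) ^ m) ((m : ℂ) * (z - b) ^ (m - 1)) z :=
        (((hasDerivAt_id' z).sub_const b).fun_pow m).congr_deriv (mul_one _)
      exact hp.mul (hUd.differentiableAt (isOpen_ball.mem_nhds hzball)).hasDerivAt
    have hdeq : (N : ℂ) * (z - b) ^ (N - 1) * F z + (z - b) ^ N * (F z * -(q₁ z)) =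
        (m : ℂ) * (z - b) ^ (m - 1) * U z + (z - b) ^ m * deriv U z := by
      rw [← hdV.deriv, ← hdU.deriv]
      exact hev.deriv_eq
    -- multiply by `(z - b)` and substitute `(z-b)^N F = (z-b)^m U`
    have hVU : (z - b) ^ N * F z = (z - b) ^ m * U z := by
      have := hev.self_of_nhds
      simpa [hV] using this
    have hX : (z - b) ^ m * U z ≠ 0 := mul_ne_zero (pow_ne_zero _ hzb) (hU0 z hzball)
    have hkey : (z - b) * ((N : ℂ) * (z - b) ^ (N - 1) * F z + (z - b) ^ N * (F z * -(q₁ z))) =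
        (z - b) * ((m : ℂ) * (z - b) ^ (m - 1) * U z + (z - b) ^ m * deriv U z) := by rw [hdeq]
    have hL1 : (z - b) * ((N : ℂ) * (z - b) ^ (N - 1) * F z + (z - b) ^ N * (F z * -(q₁ z))) =
        (N : ℂ) * ((z - b) ^ m * U z) - (z - b) * ((z - b) ^ m * U z) * q₁ z := by
      rw [← hVU]
      have := sub_mul_natDeriv_pow z b N
      linear_combination (F z) * this
    have hUz : U z ≠ 0 := hU0 z hzball
    have hL2 : (z - b) * ((m : ℂ) * (z - b) ^ (m - 1) * U z + (z - b) ^ m * deriv U z) =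
        (m : ℂ) * ((z - b) ^ m * U z) + (z - b) * ((z - b) ^ m * U z) * L z := by
      have h1 := sub_mul_natDeriv_pow z b m
      have h2 : (z - b) * ((z - b) ^ m * U z) * L z = (z - b) * (z - b) ^ m * deriv U z := by
        simp only [hL]
        field_simp
      rw [h2]
      linear_combination (U z) * h1
    rw [hL1, hL2] at hkey
    set X : ℂ := (z - b) ^ m * U z with hX'
    have hX2 : (z - b) * X ≠ 0 := mul_ne_zero hzb hX
    have hmain : q₁ z * ((z - b) * X) = (((N : ℂ) - m) - (z - b) * L z) * X := by linear_combination -hkey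
    calc q₁ z = q₁ z * ((z - b) * X) / ((z - b) * X) := by rw [mul_div_assoc, div_self hX2, mul_one]
      _ = (((N : ℂ) - m) - (z - b) * L z) * X / ((z - b) * X) := by rw [hmain]
      _ = ((N : ℂ) - m) / (z - b) - L z := by field_simp
  /- Step 8: integrating over a small circle gives `N = m` -/
  set ρ₂ : ℝ := r₂ / 2 with hρ₂
  have hρ₂0 : 0 < ρ₂ := by positivity
  have hρ₂r : ρ₂ < r₂ := by rw [hρ₂]; linarith
  have hρ₂R : ρ₂ < R := hρ₂r.trans hr₂R
  have hq₁ρ₂ : (∮ z in C(b, ρ₂), q₁ z) = 0 := by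
    rw [← hq₁0]
    symm
    refine Complex.circleIntegral_eq_of_differentiable_on_annulus_off_countable hρ₂0 (by
      rw [hρ₀, hρ₂]; linarith [hr₂.1, min_le_left ρ₀ (1:ℝ)]) countable_empty ?_ ?_
    · refine hq₁d.continuousOn.mono fun z hz => hmemD.2 ⟨?_, ?_⟩
      · exact lt_of_le_of_lt (mem_closedBall.1 hz.1) hρ₀R
      · intro h
        apply hz.2
        rw [h]
        exact mem_ball_self hρ₂0
    · intro z hz
      apply hq₁d.differentiableAt (hDo.mem_nhds (hmemD.2 ⟨?_, ?_⟩))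
      · exact (mem_ball.1 hz.1.1).trans hρ₀R
      · intro h
        apply hz.1.2
        rw [h]
        exact mem_closedBall_self hρ₂0.le
  have hNm : N = m := by
    have hsph : sphere b ρ₂ ⊆ ball b r₂ \ {b} := by
      intro z hz
      refine ⟨?_, ?_⟩
      · rw [mem_ball, mem_sphere.1 hz]; exact hρ₂r
      · intro h
        rw [h, mem_sphere, dist_self] at hz
        exact hρ₂0.ne' hz.symm
    have hcongr : (∮ z in C(b, ρ₂), q₁ z) = ∮ z in C(b, ρ₂), ((((N : ℂ) - m) * (z - b)⁻¹) - L z) := by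
      refine circleIntegral.integral_congr hρ₂0.le fun z hz => ?_
      rw [hlogder z (hsph hz), div_eq_mul_inv]
    have hci : CircleIntegrable (fun z => ((N : ℂ) - m) * (z - b)⁻¹) b ρ₂ := by
      refine ContinuousOn.circleIntegrable hρ₂0.le (ContinuousOn.mul continuousOn_const ?_)
      exact ContinuousOn.inv₀ (by fun_prop) fun z hz => sub_ne_zero.2 (hsph hz).2
    have hcL : CircleIntegrable L b ρ₂ :=
      ContinuousOn.circleIntegrable hρ₂0.le (hLd.continuousOn.mono (sphere_subset_closedBall.trans
        (closedBall_subset_ball hρ₂r)))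
    have hL0 : (∮ z in C(b, ρ₂), L z) = 0 :=
      Complex.circleIntegral_eq_zero_of_differentiable_on_off_countable hρ₂0.le countable_empty
        (hLd.continuousOn.mono (closedBall_subset_ball hρ₂r))
        (fun z hz => hLd.differentiableAt (isOpen_ball.mem_nhds (ball_subset_ball hρ₂r.le hz.1)))
    rw [hcongr, circleIntegral.integral_sub hci hcL, circleIntegral.integral_const_mul,
      circleIntegral.integral_sub_center_inv b hρ₂0.ne', hL0, sub_zero] at hq₁ρ₂
    have h2πI : (2 * π * I : ℂ) ≠ 0 := by
      simp [Real.pi_ne_zero, I_ne_zero]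
    have := (mul_eq_zero.1 hq₁ρ₂).resolve_right h2πI
    exact_mod_cast (sub_eq_zero.1 this)
  /- Step 9: `q₁ = -U'/U` near `b`: the holomorphic extension `g` -/
  have hq₁L : ∀ z ∈ ball b r₂ \ {b}, q₁ z = -L z := by
    intro z hz
    rw [hlogder z hz, hNm, sub_self, zero_div, zero_sub]
  set g : ℂ → ℂ := Function.update q₁ b (-L b) with hg
  have hgq₁ : ∀ z, z ≠ b → g z = q₁ z := fun z hz => by simp only [hg, Function.update_of_ne hz]
  have hgL : ∀ z ∈ ball b r₂, g z = -L z := by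
    intro z hz
    by_cases hzb : z = b
    · subst hzb
      simp [hg]
    · rw [hgq₁ z hzb, hq₁L z ⟨hz, hzb⟩]
  have hgd : DifferentiableOn ℂ g (ball b R) := by
    intro z hz
    by_cases hzb : z = b
    · subst hzb
      have hev : g =ᶠ[𝓝 z] fun w => -L w := by
        filter_upwards [ball_mem_nhds z hr₂0] with w hw using hgL w hw
      exact (((hLd.differentiableAt (ball_mem_nhds z hr₂0)).neg).congr_of_eventuallyEq hev).differentiableWithinAt
    · have hzD : z ∈ D := hmemD.2 ⟨mem_ball.1 hz, hzb⟩
      have hev : g =ᶠ[𝓝 z] q₁ := by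
        filter_upwards [eventually_ne_nhds hzb] with w hw using hgq₁ w hw
      exact ((hq₁d.differentiableAt (hDo.mem_nhds hzD)).congr_of_eventuallyEq hev).differentiableWithinAt
  /- Step 10: a primitive `Γ` of `g` on the disc, normalised so that `h = c log|z-b| + Re Γ` -/
  obtain ⟨Γ₀, hΓ₀⟩ := hgd.isExactOn_ball
  -- `Q₁ - Γ₀` is constant on `D`
  have hQΓ : ∀ z ∈ D, HasDerivAt (fun w => Q₁ w - Γ₀ w) 0 z := by
    intro z hz
    have h1 := hQ₁ z hz
    have h2 := hΓ₀ z (hD ▸ hz).1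
    rw [hgq₁ z (hmemD.1 hz).2] at h2
    have := h1.fun_sub h2
    rwa [sub_self] at this
  obtain ⟨z₀, hz₀⟩ : D.Nonempty := ⟨b + ρ₀, hmemD.2 ⟨by
      rw [dist_eq_norm, add_sub_cancel_left, Complex.norm_real, Real.norm_of_nonneg hρ₀0.le]; exact hρ₀R,
      fun h => by
        have : (ρ₀ : ℂ) = 0 := by simpa using h
        exact hρ₀0.ne' (by exact_mod_cast this)⟩⟩
  set κ₂ : ℂ := Q₁ z₀ - Γ₀ z₀ with hκ₂
  have hQΓc : ∀ z ∈ D, Q₁ z - Γ₀ z = κ₂ := by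
    intro z hz
    have hd : DifferentiableOn ℂ (fun w => Q₁ w - Γ₀ w) D := fun w hw =>
      (hQΓ w hw).differentiableAt.differentiableWithinAt
    exact hDo.is_const_of_deriv_eq_zero hDc hd (fun w hw => (hQΓ w hw).deriv) hz hz₀
  set Γ : ℂ → ℂ := fun z => Γ₀ z + κ₂ + (κ : ℂ) with hΓ
  have hΓd : ∀ z ∈ ball b R, HasDerivAt Γ (g z) z := fun z hz => by
    simpa [hΓ] using ((hΓ₀ z hz).add_const κ₂).add_const (κ : ℂ)
  have hhΓ : ∀ z ∈ D, h z = c * Real.log ‖z - b‖ + (Γ z).re := by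
    intro z hz
    rw [hhQ z hz, hΓ]
    have : Q₁ z = Γ₀ z + κ₂ := by rw [← hQΓc z hz]; ring
    rw [this]
    simp only [Complex.add_re, Complex.ofReal_re]
    ring
  /- Step 11: `c ≤ 0` -/
  have hc0 : c ≤ 0 := by
    by_contra hcpos
    push Not at hcpos
    have hΓc : ContinuousAt Γ b := (hΓd b (mem_ball_self hR)).continuousAt
    obtain ⟨δ, hδ, hδΓ⟩ := Metric.continuousAt_iff.1 hΓc 1 one_pos
    set t₀ : ℝ := Real.exp ((M - (Γ b).re - 2) / c) with ht₀
    set t : ℝ := min (δ / 2) (min (R / 2) t₀) with ht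
    have ht0 : 0 < t := by positivity
    have htδ : t < δ := by
      have : t ≤ δ / 2 := min_le_left _ _
      linarith
    have htR : t < R := by
      have : t ≤ R / 2 := (min_le_right _ _).trans (min_le_left _ _)
      linarith
    have htt₀ : t ≤ t₀ := (min_le_right _ _).trans (min_le_right _ _)
    set z : ℂ := b + t with hz
    have hzb : z - b = t := by rw [hz]; ring
    have hzD : z ∈ D := hmemD.2 ⟨by
        rw [dist_eq_norm, hzb, Complex.norm_real, Real.norm_eq_abs, abs_of_pos ht0]; exact htR,
      fun h0 => by
        have : (t : ℂ) = 0 := by rw [← hzb, h0, sub_self]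
        exact ht0.ne' (by exact_mod_cast this)⟩
    have hΓz : (Γ z).re ≤ (Γ b).re + 1 := by
      have hdist : dist z b < δ := by
        rw [dist_eq_norm, hzb, Complex.norm_real, Real.norm_eq_abs, abs_of_pos ht0]; exact htδ
      have h1 := hδΓ hdist
      rw [dist_eq_norm] at h1
      have h2 : |(Γ z - Γ b).re| ≤ ‖Γ z - Γ b‖ := abs_re_le_norm _
      rw [Complex.sub_re] at h2
      have h3 := le_abs_self ((Γ z).re - (Γ b).re)
      linarith
    have hhz := hhΓ z hzD
    rw [hzb, Complex.norm_real, Real.norm_eq_abs, abs_of_pos ht0] at hhz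
    have hlogt : Real.log t ≤ (M - (Γ b).re - 2) / c := by
      calc Real.log t ≤ Real.log t₀ := Real.log_le_log ht0 htt₀
        _ = (M - (Γ b).re - 2) / c := by rw [ht₀, Real.log_exp]
    have h1 : c * Real.log t ≤ M - (Γ b).re - 2 := by
      have := mul_le_mul_of_nonneg_left hlogt hcpos.le
      rwa [mul_div_cancel₀ _ hcpos.ne'] at this
    have h2 : M ≤ h z := hM z hzD
    linarith
  exact ⟨c, hc0, g, Γ, hgd, hΓd, fun z hz => by rw [hgq₁ z (hmemD.1 hz).2, hq₁]; ring, hhΓ⟩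

/-- **Bôcher's theorem** (planar case). A function harmonic on a punctured disc `B(b,R) ∖ {b}` and
bounded below there is `c log|z-b| + v` with a constant `c ≤ 0` and `v` harmonic on `B(b,R)`
(i.e. `u = β log(1/|z-b|) + v` with `β = -c ≥ 0`).
[cite: AxlerBourdonRamey2001, Thm. 3.9 (Bôcher's theorem), planar case] -/
theorem exists_log_add_harmonic_of_harmonic_bddBelow {u : ℂ → ℝ} {b : ℂ} {R M : ℝ} (hR : 0 < R)
    (hu : ∀ z ∈ ball b R \ {b}, HarmonicAt u z) (hM : ∀ z ∈ ball b R \ {b}, M ≤ u z) :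
    ∃ c : ℝ, c ≤ 0 ∧ ∃ v : ℂ → ℝ, HarmonicOnNhd v (ball b R) ∧
      ∀ z ∈ ball b R \ {b}, u z = c * Real.log ‖z - b‖ + v z := by
  have hq : DifferentiableOn ℂ (cgrad u) (ball b R \ {b}) := fun z hz =>
    (differentiableAt_cgrad (hu z hz)).differentiableWithinAt
  have hh : ∀ z ∈ ball b R \ {b}, HasFDerivAt u (fderiv ℝ u z) z := fun z hz =>
    ((hu z hz).1.differentiableAt two_ne_zero).hasFDerivAt
  obtain ⟨c, hc0, g, Γ, hgd, hΓd, -, huΓ⟩ := exists_simplePole_of_re_primitive_bddBelow hR hq hh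
    (fun z _ v => fderiv_apply_eq_re_cgrad_mul u z v) hM
  refine ⟨c, hc0, fun z => (Γ z).re, fun z hz => ?_, huΓ⟩
  have han : AnalyticAt ℂ Γ z :=
    DifferentiableOn.analyticAt (fun w hw => (hΓd w hw).differentiableAt.differentiableWithinAt)
      (isOpen_ball.mem_nhds hz)
  exact han.harmonicAt_re

end Literature.Analysis.Complex

end
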